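import Mathlib.Analysis.Matrix.HermitianFunctionalCalculus
import Mathlib.Data.Real.Sign
import Literature.MathematicalPhysics.QuantumLattice.DuhamelTwoPoint

/-!
# The negative spectral projector of a nonsingular Hermitian matrix is `½(1 − sgn)`

For a Hermitian matrix `H` (finite-dimensional, complex) the **Fermi projector** (negative spectral projector)
`P₋(H) = 1_{(-∞,0)}(H)` and the **sign matrix** `sgn(H) = sign(H)` (functional calculus, `sign 0 = 0`) satisfy
`1 = P₊ + P₀ + P₋`, `sgn = P₊ − P₋`, hence `P₋ = ½(1 − sgn − P₀)`; when `H` is nonsingular the kernel projector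
`P₀` vanishes and `P₋(H) = ½(1 − sgn(H))`.  In particular OFF THE DIAGONAL the two kernels agree up to the
factor `−½`: `P₋(H)(a,b) = −½ sgn(H)(a,b)` for `a ≠ b`, so decay/locality statements for `sgn(H)` (the
currency of the Aizenman–Graf representation `π sgn(H) = PV∫_{|η|≤Y}(H − iη)⁻¹dη + 2 arctan(H/Y)`) transfer
verbatim to the Fermi projector.  Aizenman–Graf, J. Phys. A 31 (1998) 6783, §2; Aizenman–Warzel,
*Random operators* (GSM 168), §13.1; folklore linear algebra.

Here `cfc` is Mathlib's continuous functional calculus of a Hermitian matrix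
(`Mathlib.Analysis.Matrix.HermitianFunctionalCalculus`), computed in an eigenbasis by
`Matrix.IsHermitian.cfc_eq_conj_diagonal` (tree, `DuhamelTwoPoint.lean`).
-/

noncomputable section

open scoped BigOperators ComplexConjugate
open Matrix

namespace Literature.Analysis.Matrix

variable {n : Type*} [Fintype n] [DecidableEq n]

/-- **`P₋(H) = ½(1 − sgn(H))` for a nonsingular Hermitian matrix.**  With `P₋(H) := 1_{(-∞,0)}(H)` and
`sgn(H) := sign(H)` (continuous functional calculus; `Real.sign 0 = 0`): if `det H ≠ 0` then
`cfc 1_{(<0)} H = ½ • (1 − cfc sign H)`. [folklore] -/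
theorem cfc_indicator_neg_eq_half_one_sub_cfc_sign {H : Matrix n n ℂ} (hH : H.IsHermitian) (hdet : H.det ≠ 0) :
    cfc (fun t : ℝ => if t < 0 then (1 : ℝ) else 0) H = (1 / 2 : ℂ) • (1 - cfc Real.sign H) := by
  set U : Matrix n n ℂ := (hH.eigenvectorUnitary : Matrix n n ℂ) with hU
  have hUm : U ∈ unitary (Matrix n n ℂ) := hH.eigenvectorUnitary.prop
  -- no zero eigenvalue
  have hev : ∀ i, hH.eigenvalues i ≠ 0 := by
    intro i h0
    apply hdet
    rw [hH.det_eq_prod_eigenvalues]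
    exact Finset.prod_eq_zero (Finset.mem_univ i) (by rw [h0]; simp)
  -- both sides in the eigenbasis
  have h1 : (1 : Matrix n n ℂ) = U * diagonal (fun _ => (1 : ℂ)) * star U := by
    rw [diagonal_one, Matrix.mul_one, Unitary.mul_star_self_of_mem hUm]
  -- `U diag(a) U⋆ − U diag(b) U⋆ = U diag(a − b) U⋆` (cf. the tree's `SolovayKitaev.conj_diagonal_sub`)
  have hsub : ∀ a b : n → ℂ,
      U * diagonal a * star U - U * diagonal b * star U = U * diagonal (a - b) * star U := fun a b => by
    rw [← Matrix.sub_mul, ← Matrix.mul_sub, diagonal_sub]; rfl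
  rw [hH.cfc_eq_conj_diagonal, hH.cfc_eq_conj_diagonal, ← hU, h1, hsub, ← Matrix.smul_mul,
    ← Matrix.mul_smul, ← diagonal_smul]
  congr 3
  funext i
  simp only [Pi.smul_apply, Pi.sub_apply, smul_eq_mul]
  rcases lt_or_gt_of_ne (hev i) with hneg | hpos
  · rw [if_pos hneg, Real.sign_of_neg hneg]
    push_cast
    ring
  · rw [if_neg (not_lt.2 hpos.le), Real.sign_of_pos hpos]
    push_cast
    ring

/-- **Off the diagonal the Fermi projector is `−½` times the sign matrix**: for a nonsingular Hermitian `H`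
and `a ≠ b`, `P₋(H)(a,b) = −½ · sgn(H)(a,b)`. [folklore] -/
theorem cfc_indicator_neg_apply_of_ne {H : Matrix n n ℂ} (hH : H.IsHermitian) (hdet : H.det ≠ 0)
    {a b : n} (hab : a ≠ b) :
    (cfc (fun t : ℝ => if t < 0 then (1 : ℝ) else 0) H) a b = -(1 / 2 : ℂ) * (cfc Real.sign H) a b := by
  rw [cfc_indicator_neg_eq_half_one_sub_cfc_sign hH hdet, Matrix.smul_apply, Matrix.sub_apply,
    Matrix.one_apply_ne hab, zero_sub, smul_eq_mul]
  ring

/-- **Norm form**: for a nonsingular Hermitian `H` and `a ≠ b`, `‖P₋(H)(a,b)‖ = ½ ‖sgn(H)(a,b)‖` — so every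
off-diagonal decay bound for the sign matrix is one for the Fermi projector. [folklore] -/
theorem norm_cfc_indicator_neg_apply_of_ne {H : Matrix n n ℂ} (hH : H.IsHermitian) (hdet : H.det ≠ 0)
    {a b : n} (hab : a ≠ b) :
    ‖(cfc (fun t : ℝ => if t < 0 then (1 : ℝ) else 0) H) a b‖ = 1 / 2 * ‖(cfc Real.sign H) a b‖ := by
  rw [cfc_indicator_neg_apply_of_ne hH hdet hab, norm_mul, norm_neg]
  norm_num

end Literature.Analysis.Matrix

end
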